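import Mathlib
import Literature.MathematicalPhysics.QuantumLattice.WilsonDiracAP
import Summits.QuantumFields.QCD.Theorems.QuarksAsStableActionCriticalLineDiamagnetismStubBlockReduction
import Summits.QuantumFields.QCD.Theorems.QuarksAsStableActionCriticalLineDiamagnetismStubBlockClosedForm
import Summits.QuantumFields.QCD.Theorems.QuarksAsStableActionCriticalLineDiamagnetismCheckerEvalSoundB
import Summits.QuantumFields.QCD.Theorems.QuarksAsStableActionCriticalLineDiamagnetismCheckerCert3

/-!
# Stub P3a — `stub_blockMargin3a`: the pointwise block margin of region 3a (crux stmt-QuantumFields-9734, line `Sketch`, lead c3)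

What. For a block twist `θ ∈ (0,π)⁴` of region 3a of the skeleton (`Lines/Sketch.lean`), scalar links `u_μ = e^{iθ_μ}·1`,
and every anti-Hermitian tiling-odd link field `Y` on the `2⁴` torus: `γ·𝒦(Y) ≤ Q(Y)` with `γ = -(1 / 1000)`, where `Q` is the
one-loop block Hessian and `𝒦` the linearised Wilson plaquette form.

How. ASSEMBLY: `stub_blockReduction` (reduction to the per-class quadratic-form inequality on `1^⊥`) with
`γ = -(1 / 1000)`; its hypothesis is, entry by entry on the active axes, the statement about the real closed form
(`stub_blockClosedForm`, definitionally `Checker.blockHc (cos ∘ θ)`), which is `Checker.region_sound` applied to the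
CERTIFICATE `Checker.stub_checkerCert3` (`…CheckerCert3.lean`, `native_decide`) at the point `C = cos ∘ θ` of
`C`-region `3` (`Checker.inRegion_cos_three`).
-/

noncomputable section

open scoped BigOperators Classical Matrix ComplexConjugate
open Finset
open Literature.MathematicalPhysics.QuantumLattice Literature.MathematicalPhysics.QuantumFieldTheory
  Literature.Probability.LatticeModels

namespace Summit.QuantumFields.QCD.Cruxes.CriticalLineDiamagnetism.ChessboardCellGain

/-- **Stub P3a — `stub_blockMargin3a`** (region 3a, `γ = -(1 / 1000)`): block reduction + closed form + the certified
computation of region 3. -/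
theorem stub_blockMargin3a : ∀ (θ : Fin 4 → ℝ), (∀ μ, 0 < θ μ ∧ θ μ < Real.pi) → 3 ≤ (Finset.univ.filter (fun μ : Fin 4 => min (θ μ) (Real.pi - θ μ) < 1 / 2)).card → ¬ (∀ μ : Fin 4, min (θ μ) (Real.pi - θ μ) < 1 / 20) → ∀ (u : Fin 4 → Matrix.unitaryGroup (Fin 3) ℂ), (∀ μ, ((u μ : Matrix.unitaryGroup (Fin 3) ℂ) : Matrix (Fin 3) (Fin 3) ℂ) = Complex.exp (↑(θ μ) * Complex.I) • (1 : Matrix (Fin 3) (Fin 3) ℂ)) → let B0 : Matrix (TorusSite 4 2 × Fin 3 × Fin 4) (TorusSite 4 2 × Fin 3 × Fin 4) ℂ := wilsonDirac (unitaryFundamentalRep (Fin 3) ℂ) (fun e : Edge 4 2 => u e.2) 0 1; let Dl : (Edge 4 2 → Matrix (Fin 3) (Fin 3) ℂ) → Matrix (TorusSite 4 2 × Fin 3 × Fin 4) (TorusSite 4 2 × Fin 3 × Fin 4) ℂ := fun E => Matrix.of fun p q => -(1 / 2 : ℂ) * ∑ μ : Fin 4, ((if q.1 = Site.shift p.1 μ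 then ((1 : Matrix (Fin 4) (Fin 4) ℂ) - euclideanGamma μ) p.2.2 q.2.2 * (((u μ : Matrix.unitaryGroup (Fin 3) ℂ) : Matrix (Fin 3) (Fin 3) ℂ) * E (p.1, μ)) p.2.1 q.2.1 else 0) + (if p.1 = Site.shift q.1 μ then ((1 : Matrix (Fin 4) (Fin 4) ℂ) + euclideanGamma μ) p.2.2 q.2.2 * (((u μ : Matrix.unitaryGroup (Fin 3) ℂ) : Matrix (Fin 3) (Fin 3) ℂ) * E (q.1, μ))ᴴ p.2.1 q.2.1 else 0)); ∀ Y : Edge 4 2 → Matrix (Fin 3) (Fin 3) ℂ, (∀ e, (Y e)ᴴ = -Y e) → (∀ (x : TorusSite 4 2) (μ : Fin 4), Y (Site.shift x μ, μ) = -Y (x, μ)) → -(1 / 1000 : ℝ) * (∑ p : Plaquette 4 2, ∑ a, ∑ b, ‖(Y (p.1, p.2.1.1) + Y (Site.shift p.1 p.2.1.1, p.2.1.2) - Y (Site.shift p.1 p.2.1.2, p.2.1.1) - Y (p.1, p.2.1.2)) a b‖ ^ 2) ≤ ((B0⁻¹ * Dl Y * (B0⁻¹ * Dl Y)).trace.re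 / 2 - (B0⁻¹ * Dl (fun e => Y e * Y e)).trace.re / 2) := by
  intro θ hθ hreg hnc u hu B0 Dl Y hY hodd
  refine stub_blockReduction θ u hθ hu (-(1 / 1000)) ?_ Y hY hodd
  intro s y hsupp hsum
  have hCF := stub_blockClosedForm θ hθ
  have h01 : ∀ a : ZMod 2, a ≠ 1 → a = 0 := by decide
  have hIn := Checker.inRegion_cos_three θ hθ hreg hnc
  have hBM := (Checker.region_sound (-(1 / 1000)) 60 3 (by norm_num) Checker.stub_checkerCert3 _ hIn s).le y hsupp hsum
  refine le_of_le_of_eq (le_of_eq_of_le ?_ hBM) ?_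
  · unfold Checker.nAct; push_cast; ring
  · refine Finset.sum_congr rfl fun μ _ => Finset.sum_congr rfl fun ν _ => ?_
    by_cases hμ : s μ = 1
    · by_cases hν : s ν = 1
      · exact congrArg (· * (y μ * y ν)) (hCF s μ ν hμ hν).symm
      · rw [hsupp ν (h01 _ hν)]; ring
    · rw [hsupp μ (h01 _ hμ)]; ring

end Summit.QuantumFields.QCD.Cruxes.CriticalLineDiamagnetism.ChessboardCellGain

end
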